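import Summits.ResolutionOfSingularities.ResolutionOfSingularities.Theorems.HilbertSamuelEliminationSigmaMaxModificationsCorridor3CPFrameFaceVertex
import Literature.AlgebraicGeometry.Resolution.SymbolicPowersRsop
import Mathlib.RingTheory.DiscreteValuationRing.TFAE
import Mathlib.RingTheory.Localization.FractionRing
import Mathlib.RingTheory.Localization.Algebra
import Mathlib.Algebra.Polynomial.FieldDivision
import Mathlib.RingTheory.IntegralClosure.IntegrallyClosed
import HarnessLib

/-!
# [OURS · L1 W4.2] D18 — THE FACE READING: in a MINIMAL CP frame, a codimension-two face of the frame carrying multiplicity `m`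
# is `V(X, u_T)` and is LEGAL (`f_{i,X} ∈ (u_T)^i`) — Cossart–Piltant 2019 Prop. 2.3 over the generic point of the face, from full minimality
# (cell res-hironaka, LADDER-RESOLUTION rung L; slot W4.2, crux chain w42 `SigmaMaxModificationsCorridor3` stmt-ResolutionOfSingularities-19249;
# `--supports stmt-ResolutionOfSingularities-19249 --as helper`; res-L1-w42-plan-1 RULING v3.14-42 part 2 (KG)(2) «(G8) → (G7) → hread_menu»;
# hand res-D-brk-3 (gen 7), file F1b of DESIGN 17:06:09Z — replaces «G7 legality from Bennett»)

PURE COMMUTATIVE ALGEBRA, 0 `def`s, every declaration PROVED; OURS bookkeeping; NOT a statement of Hironaka's manuscript [Hironaka2017] nor of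
[CossartPiltant2019]/[CossartJannsenSaito2020]. AI-written, weaker than expert review.

WHY. The chain theorem `Moving.exists_isCPFrame_of_reaches` (p548461) carries ONE binder `hread`: every canonical centre must be READ, in some CP
frame `(R, u, h, φ)` of its stage, as `V(X, u_T)` with the legality `∀ i ∈ Icc 1 m, coeff_{m−i} h ∈ (u_T)^i` (CP's `δ_T ≥ 1`). For the σ-layer's
MENU centres (067's `IsMenuCentreAt`: the reduced structure on a component through `x_n` of `X(ν) ∩ V(I_j) ∩ V(I_k)` for boundary members
`I_j, I_k`), in a frame ADAPTED to the boundary (`I_j ↦ (u_j)`, `I_k ↦ (u_k)`) the centre germ is a prime `𝔔 ⊂ R[X]` over the generic point of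
the face `W = V(u_j, u_k)` at which `h` has multiplicity `m` (the ν-stratum is the multiplicity-`m` locus of the hypersurface). THIS FILE proves that
then — because the frame's polyhedron `Δ(h; u; X)` is MINIMAL (a clause of res-type-067's `IsCPFrame`) — `𝔔` IS `(X, u_j, u_k)` and the legality
HOLDS. No re-preparation `Z = X − θ` and no Bennett/normal-flatness argument are needed: this is how Cossart–Piltant's own proof of their Prop. 2.7
(arXiv v1 p. 14) obtains `I(𝒴) = (Z, {u_j}_{j∈J})` and `f_{i,Z} ∈ I_J^i` from Prop. 2.3 at `S_{s^J}` and Prop. 2.4; for `|J| = n − 1` part 1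
(`…CPFrameFaceVertex`) gives the direct argument from FULL minimality, avoiding the projection statement of Prop. 2.4.

* §1 `exists_eq_X_sub_C_pow_of_mul_mem_pow` — over an integrally closed domain `D`: a monic `g` of degree `m` with multiplicity `m` at a prime `Q`
  of `D[X]` over `(0)` is `(X − λ)^m`, `λ ∈ D`, and `Q = (X − λ)` (via `K[X]`, `K = Frac D`, Mathlib `Polynomial.isLocalization`).
* §2 **`eq_span_and_coeff_mem_pow_of_isMinimal_of_mul_mem_pow`** — THE FACE READING: `R` equicharacteristic regular local of dimension `n`,
  r.s.p. `u`, `h` monic of degree `m ≥ 1`, `IsMinimal u h`, `T = univ ∖ {i₀}`, `𝔔` prime of `R[X]` with `𝔔 ∩ R = (u_T)` and `s·h ∈ 𝔔^m`, `s ∉ 𝔔`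
  ⟹ `𝔔 = (u_T)·R[X] + (X)` ∧ `∀ i ∈ Icc 1 m, coeff_{m−i} h ∈ (u_T)^i`. (`R/(u_T)` is a DVR, Mathlib `tfae_of_isNoetherianRing_of_isLocalRing_of_isDomain`;
  `h ≡ (X − λ)^m`, `λ ≡ c·u_{i₀}^r` ⇒ part 1 ⇒ `λ ≡ 0`; legality from `s·h ∈ 𝔔^m` by the coefficient calculus of part 1 §1 and `(u_T)^k : s₀ = (u_T)^k`,
  tree `mem_pow_span_image_rsop_of_mul_mem`, Matsumura Thm. 16.2 (ii).)

Consumers: F3 `…CPFramePropagationMenuChain` (scheme dictionary: menu curve ↦ `𝔔`) of the same hand.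

References: V. Cossart, O. Piltant, J. Algebra 529 (2019) = arXiv:1412.0868v1, Prop. 2.3, Prop. 2.4, Def. 2.7, proof of Prop. 2.7 (pp. 11–14)
[CossartPiltant2019]; H. Matsumura, *Commutative Ring Theory*, Thms. 8.10, 11.2, 16.2 [Matsumura1987]; tree `Literature…SymbolicPowersRsop`.
-/

noncomputable section

set_option linter.dupNamespace false

open IsLocalRing Polynomial Finset
open Literature.AlgebraicGeometry.Resolution Literature.AlgebraicGeometry.Resolution.CossartPiltant

universe u

namespace Summit.ResolutionOfSingularities.ResolutionOfSingularities.Theorems.SigmaMaxModificationsCorridor3.Helpers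

/-! ## §1. A prime of `D[X]` over `(0)` at which a monic `g` has multiplicity `deg g`: `g = (X − λ)^m`, `λ ∈ D` -/

section Root

variable {D : Type u} [CommRing D] [IsDomain D] [IsIntegrallyClosed D]

/-- Over an integrally closed domain `D`: if `g ∈ D[X]` is monic of degree `m ≥ 1` and `Q` is a prime of `D[X]` lying over `(0)` with
`s·g ∈ Q^m` for some `s ∉ Q` (multiplicity `m` at `Q`), then `g = (X − λ)^m` for some `λ ∈ D` and `Q = (X − λ)`. (Pass to `K[X]`,
`K = Frac D`, a PID: `Q·K[X] = (P)`, `P^m ∣ g`, so `deg P = 1`, `g = (X − λ)^m` in `K[X]`; `λ` is integral over `D`.) [folklore] -/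
theorem exists_eq_X_sub_C_pow_of_mul_mem_pow {g : D[X]} (hg : g.Monic) (hm : 0 < g.natDegree) (Q : Ideal D[X]) [hQ : Q.IsPrime]
    (hQ0 : Q.comap (C : D →+* D[X]) = ⊥) (hord : ∃ s ∉ Q, s * g ∈ Q ^ g.natDegree) :
    ∃ lam : D, g = (X - C lam) ^ g.natDegree ∧ Q = Ideal.span {X - C lam} := by
  classical
  set K := FractionRing D with hK
  letI algKX : Algebra D[X] K[X] := (mapRingHom (algebraMap D K)).toAlgebra
  haveI hloc : IsLocalization ((nonZeroDivisors D).map (C : D →+* D[X])) K[X] := Polynomial.isLocalization (nonZeroDivisors D) K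
  have halg : ∀ q : D[X], algebraMap D[X] K[X] q = q.map (algebraMap D K) := fun q => rfl
  -- `Q` misses the multiplicative set `C(D ∖ 0)`
  have hdisj : Disjoint (((nonZeroDivisors D).map (C : D →+* D[X])) : Set D[X]) (Q : Set D[X]) := by
    rw [Set.disjoint_left]
    rintro _ ⟨d, hd, rfl⟩ hdQ
    have : d ∈ Q.comap (C : D →+* D[X]) := hdQ
    rw [hQ0, Ideal.mem_bot] at this
    exact nonZeroDivisors.ne_zero hd this
  set Q' : Ideal K[X] := Q.map (algebraMap D[X] K[X]) with hQ'
  haveI hQ'p : Q'.IsPrime := IsLocalization.isPrime_of_isPrime_disjoint _ K[X] Q hQ hdisj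
  have hcomap : Q'.comap (algebraMap D[X] K[X]) = Q := IsLocalization.under_map_of_isPrime_disjoint _ K[X] hQ hdisj
  obtain ⟨s, hsQ, hsg⟩ := hord
  -- `Q' = (P)` with `P` prime
  obtain ⟨P, hP⟩ := (Submodule.IsPrincipal.principal Q' : ∃ P, Q' = Submodule.span K[X] {P})
  have hP' : Q' = Ideal.span {P} := hP
  have hgK : (algebraMap D[X] K[X] g).Monic := by rw [halg]; exact hg.map _
  have hgQ' : algebraMap D[X] K[X] g ∈ Q' := by
    apply Ideal.mem_map_of_mem
    have : s * g ∈ Q := Ideal.pow_le_self hm.ne' hsg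
    exact (hQ.mem_or_mem this).resolve_left hsQ
  have hP0 : P ≠ 0 := by
    intro h0
    rw [hP', h0, Ideal.span_singleton_zero] at hgQ'
    exact hgK.ne_zero (Ideal.mem_bot.mp hgQ')
  have hPprime : Prime P := (Ideal.span_singleton_prime hP0).mp (hP' ▸ hQ'p)
  -- `P^m ∣ g` in `K[X]`
  have hsK : ¬ P ∣ algebraMap D[X] K[X] s := by
    intro hdvd
    apply hsQ
    rw [← hcomap, Ideal.mem_comap, hP']
    exact Ideal.mem_span_singleton.mpr hdvd
  have hsgK : P ^ g.natDegree ∣ algebraMap D[X] K[X] s * algebraMap D[X] K[X] g := by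
    rw [← map_mul, ← Ideal.mem_span_singleton, ← Ideal.span_singleton_pow, ← hP', hQ', ← Ideal.map_pow]
    exact Ideal.mem_map_of_mem _ hsg
  have hdvd : P ^ g.natDegree ∣ algebraMap D[X] K[X] g := hPprime.pow_dvd_of_dvd_mul_left _ hsK hsgK
  -- degrees: `deg P = 1`
  have hPdeg : 1 ≤ P.natDegree := by
    rw [Nat.one_le_iff_ne_zero]
    intro h0
    have hu : IsUnit P := by
      rw [Polynomial.eq_C_of_natDegree_eq_zero h0]
      refine (Polynomial.isUnit_C).mpr (IsUnit.mk0 _ fun hc => hP0 ?_)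
      rw [Polynomial.eq_C_of_natDegree_eq_zero h0, hc, map_zero]
    exact hPprime.not_unit hu
  have hdegle : (P ^ g.natDegree).natDegree ≤ (algebraMap D[X] K[X] g).natDegree :=
    Polynomial.natDegree_le_of_dvd hdvd hgK.ne_zero
  rw [Polynomial.natDegree_pow, halg, hg.natDegree_map] at hdegle
  have hPdeg1 : P.natDegree = 1 := by
    have : g.natDegree * P.natDegree ≤ g.natDegree * 1 := by simpa using hdegle
    exact le_antisymm (Nat.le_of_mul_le_mul_left this hm) hPdeg
  -- normalise `P` to the monic `X - C μ`
  set μ : K := - (P.coeff 0 * (P.leadingCoeff)⁻¹) with hμ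
  have hlc : P.leadingCoeff ≠ 0 := Polynomial.leadingCoeff_ne_zero.mpr hP0
  have hPμ : P = C P.leadingCoeff * (X - C μ) := by
    have hlc1 : P.leadingCoeff = P.coeff 1 := by rw [Polynomial.leadingCoeff, hPdeg1]
    conv_lhs => rw [Polynomial.eq_X_add_C_of_natDegree_le_one hPdeg1.le]
    rw [hμ, map_neg, sub_neg_eq_add, mul_add, ← map_mul, mul_comm (P.coeff 0), ← mul_assoc, mul_inv_cancel₀ hlc, one_mul,
      hlc1]
  have hkey : P * C (P.leadingCoeff⁻¹) = X - C μ := by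
    have h1 : P * C (P.leadingCoeff⁻¹) = C P.leadingCoeff * (X - C μ) * C (P.leadingCoeff⁻¹) :=
      congrArg (· * C (P.leadingCoeff⁻¹)) hPμ
    rw [h1, mul_comm (C P.leadingCoeff) (X - C μ), mul_assoc, ← map_mul, mul_inv_cancel₀ hlc, map_one, mul_one]
  have hassoc : Associated P (X - C μ) :=
    ⟨(Polynomial.isUnit_C.mpr (IsUnit.mk0 _ (inv_ne_zero hlc))).unit, by rw [IsUnit.unit_spec, hkey]⟩
  have hdvd' : (X - C μ) ^ g.natDegree ∣ algebraMap D[X] K[X] g :=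
    ((hassoc.symm.pow_pow).dvd).trans hdvd
  have hgeq : algebraMap D[X] K[X] g = (X - C μ) ^ g.natDegree := by
    refine Polynomial.eq_of_monic_of_dvd_of_natDegree_le ((monic_X_sub_C μ).pow _) hgK hdvd' ?_
    rw [natDegree_pow, natDegree_X_sub_C, mul_one, halg, hg.natDegree_map]
  -- `μ` is integral over `D`, hence in `D`
  have hμint : IsIntegral D μ := by
    refine ⟨g, hg, ?_⟩
    have h1 : eval μ (algebraMap D[X] K[X] g) = 0 := by
      rw [hgeq, eval_pow, eval_sub, eval_X, eval_C, sub_self, zero_pow hm.ne']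
    rwa [halg, eval_map] at h1
  obtain ⟨lam, hlam⟩ := IsIntegrallyClosed.isIntegral_iff.mp hμint
  refine ⟨lam, ?_, ?_⟩
  · apply Polynomial.map_injective (algebraMap D K) (IsFractionRing.injective D K)
    rw [← halg, hgeq, Polynomial.map_pow, Polynomial.map_sub, map_X, map_C, hlam]
  · rw [← hcomap, hP']
    ext q
    rw [Ideal.mem_comap, Ideal.mem_span_singleton, Ideal.mem_span_singleton, hassoc.dvd_iff_dvd_left, halg,
      show (X - C μ : K[X]) = (X - C lam).map (algebraMap D K) by rw [Polynomial.map_sub, map_X, map_C, hlam]]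
    exact Polynomial.map_dvd_map (algebraMap D K) (IsFractionRing.injective D K) (monic_X_sub_C lam)

end Root

/-! ## §2. The face reading: in a MINIMAL frame a codimension-two face of the frame carrying multiplicity `m` is `V(X, u_T)` and is legal -/

section Face

variable {R : Type u} [CommRing R] [IsRegularLocalRing R]

/-- Order of a non-zero element of a Noetherian local ring (Krull). [cite: Matsumura1987, Thm. 8.10] -/
private theorem exists_mem_pow_not_mem_pow_succ' {A : Type*} [CommRing A] [IsLocalRing A] [IsNoetherianRing A] {g : A}
    (hg : g ≠ 0) : ∃ μ : ℕ, g ∈ maximalIdeal A ^ μ ∧ g ∉ maximalIdeal A ^ (μ + 1) := by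
  classical
  have hex : ∃ k : ℕ, g ∉ maximalIdeal A ^ k := by
    by_contra hall
    push Not at hall
    have hmem : g ∈ ⨅ k : ℕ, maximalIdeal A ^ k := Ideal.mem_iInf.mpr hall
    rw [Ideal.iInf_pow_eq_bot_of_isLocalRing _ (maximalIdeal.isMaximal A).ne_top, Ideal.mem_bot] at hmem
    exact hg hmem
  have h0 : Nat.find hex ≠ 0 := by
    intro h
    have := Nat.find_spec hex
    rw [h, pow_zero, Ideal.one_eq_top] at this
    exact this trivial
  refine ⟨Nat.find hex - 1, ?_, ?_⟩
  · have := Nat.find_min hex (m := Nat.find hex - 1) (by omega)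
    simpa using this
  · rw [Nat.sub_add_cancel (Nat.one_le_iff_ne_zero.mpr h0)]
    exact Nat.find_spec hex

/-- [OURS · L1 W4.2] **THE FACE READING (CP 2019 Prop. 2.3 (ii) + proof of (i) over the generic point of a codimension-two face of
the frame, from FULL minimality).** Let `R` be an equicharacteristic regular local ring of dimension `n` with r.s.p. `u`, `h ∈ R[X]`
monic of degree `m ≥ 1` with `Δ(h; u; X)` MINIMAL (`CossartPiltant.IsMinimal u h`), `T` all indices but one, and `𝔔` a prime of `R[X]`
lying over the generic point of the face `W = V(u_T)` (`𝔔 ∩ R = (u_T)`) at which `h` has MULTIPLICITY `m` (`s·h ∈ 𝔔^m` for some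
`s ∉ 𝔔`). THEN `𝔔 = (u_T)·R[X] + (X)` — the point of `Sing_m` over `s^T` is `(X, u_T)` — AND `h` is LEGAL along the face:
`f_{i,X} = coeff_{m−i} h ∈ (u_T)^i` for `1 ≤ i ≤ m` (CP's `δ(y) ≥ 1 ⇒ f_{i,Z} ∈ I_J^i`). (Over `D = R/(u_T)`, a DVR: `h ≡ (X − λ)^m` with
`λ = c·u_{i₀}^r`, and `r·e_{i₀}` would be a solvable vertex unless `λ ≡ 0`; then the `(u_T)·R[X] + (X)`-primary calculus with
`(u_T)^k : s₀ = (u_T)^k`.) [cite: CossartPiltant2019, Prop. 2.3 and proof of Prop. 2.7 (arXiv v1 pp. 11–12, 14)] [cite: Matsumura1987, Thm. 16.2 (ii)] -/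
theorem eq_span_and_coeff_mem_pow_of_isMinimal_of_mul_mem_pow (hchar : ∀ k : ℕ, (k : R) ≠ 0 → IsUnit (k : R))
    {n : ℕ} (hdim : ringKrullDim R = n) (u : Fin n → R) (hu : Ideal.span (Set.range u) = maximalIdeal R)
    {h : R[X]} (hmo : h.Monic) (hm : 0 < h.natDegree) (hmin : IsMinimal u h)
    (T : Finset (Fin n)) (i₀ : Fin n) (hi₀ : i₀ ∉ T) (hT : ∀ j, j ∉ T → j = i₀)
    (𝔔 : Ideal R[X]) [h𝔔p : 𝔔.IsPrime] (h𝔔 : 𝔔.comap (C : R →+* R[X]) = Ideal.span (u '' ↑T))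
    (hord : ∃ s ∉ 𝔔, s * h ∈ 𝔔 ^ h.natDegree) :
    𝔔 = (Ideal.span (u '' ↑T)).map (C : R →+* R[X]) ⊔ Ideal.span {X} ∧
      ∀ i ∈ Finset.Icc 1 h.natDegree, h.coeff (h.natDegree - i) ∈ Ideal.span (u '' ↑T) ^ i := by
  classical
  set m := h.natDegree with hmdef
  set 𝔭 := Ideal.span (u '' ↑T) with h𝔭
  -- `u` is an r.s.p.
  have hd : (maximalIdeal R).spanFinrank = n := by
    have h1 := IsRegularLocalRing.spanFinrank_maximalIdeal (R := R)
    rw [hdim] at h1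
    exact_mod_cast h1
  have hz : IsRsopPart u := ⟨‹_›, 0, Fin.elim0, by rw [hdim, Nat.add_zero], by
    rw [← hu]; congr 1; ext x; simp⟩
  have hprime : 𝔭.IsPrime := isPrime_span_image_of_isRsopPart hz T
  have hu0 : u i₀ ∉ 𝔭 := hz.not_mem_span_image (S := (↑T : Set (Fin n))) (fun h => hi₀ (Finset.mem_coe.mp h))
  have h𝔭le : 𝔭 ≤ maximalIdeal R := (Ideal.span_mono (Set.image_subset_range _ _)).trans hz.span_range_le_maximalIdeal
  have h𝔪 : maximalIdeal R = 𝔭 ⊔ Ideal.span {u i₀} := by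
    rw [← hu, h𝔭, ← Ideal.span_union]
    congr 1
    ext x
    constructor
    · rintro ⟨j, rfl⟩
      by_cases hj : j ∈ T
      · exact Or.inl ⟨j, hj, rfl⟩
      · rw [hT j hj]; exact Or.inr rfl
    · rintro (⟨j, -, rfl⟩ | rfl)
      · exact ⟨j, rfl⟩
      · exact ⟨i₀, rfl⟩
  -- the DVR `D = R/𝔭`
  set D := R ⧸ 𝔭 with hD
  haveI : IsDomain D := Ideal.Quotient.isDomain 𝔭
  haveI : IsLocalRing D := IsLocalRing.of_surjective' (Ideal.Quotient.mk 𝔭) Ideal.Quotient.mk_surjective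
  have hmk𝔪 : ∀ x : R, Ideal.Quotient.mk 𝔭 x ∈ maximalIdeal D ↔ x ∈ maximalIdeal R := by
    intro x
    rw [IsLocalRing.mem_maximalIdeal, IsLocalRing.mem_maximalIdeal, mem_nonunits_iff, mem_nonunits_iff, not_iff_not]
    constructor
    · intro hx
      obtain ⟨y, hy⟩ := hx.exists_right_inv
      obtain ⟨y, rfl⟩ := Ideal.Quotient.mk_surjective y
      rw [← map_mul, ← map_one (Ideal.Quotient.mk 𝔭), Ideal.Quotient.eq] at hy
      have hy' : 1 - x * y ∈ 𝔭 := by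
        have := 𝔭.neg_mem hy
        rwa [neg_sub] at this
      have h1 : IsUnit (x * y) := by
        have := IsLocalRing.isUnit_one_sub_self_of_mem_nonunits (1 - x * y) ((IsLocalRing.mem_maximalIdeal _).mp
          (h𝔭le hy'))
        simpa using this
      exact isUnit_of_mul_isUnit_left h1
    · exact fun hx => hx.map _
  have hmaxD : maximalIdeal D = Ideal.span {Ideal.Quotient.mk 𝔭 (u i₀)} := by
    apply le_antisymm
    · intro x hx
      obtain ⟨x, rfl⟩ := Ideal.Quotient.mk_surjective x
      have hx' := (hmk𝔪 x).mp hx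
      rw [h𝔪] at hx'
      obtain ⟨p, hp, q, hq, rfl⟩ := Submodule.mem_sup.mp hx'
      obtain ⟨d, rfl⟩ := Ideal.mem_span_singleton'.mp hq
      rw [map_add, Ideal.Quotient.eq_zero_iff_mem.mpr hp, zero_add, map_mul]
      exact Ideal.mul_mem_left _ _ (Ideal.mem_span_singleton_self _)
    · rw [Ideal.span_le, Set.singleton_subset_iff]
      exact (hmk𝔪 _).mpr (hz.mem_maximalIdeal i₀)
  have hprinc : (maximalIdeal D).IsPrincipal := ⟨⟨Ideal.Quotient.mk 𝔭 (u i₀), hmaxD⟩⟩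
  have hic : IsIntegrallyClosed D ∧ ∀ P : Ideal D, P ≠ ⊥ → P.IsPrime → P = maximalIdeal D :=
    ((tfae_of_isNoetherianRing_of_isLocalRing_of_isDomain D).out 4 3).mp hprinc
  haveI : IsIntegrallyClosed D := hic.1
  -- the reduction `ρ : R[X] → D[X]` and the prime `Q = ρ(𝔔)`
  set ρ : R[X] →+* D[X] := mapRingHom (Ideal.Quotient.mk 𝔭) with hρ
  have hρsurj : Function.Surjective ρ := Polynomial.map_surjective _ Ideal.Quotient.mk_surjective
  have hker : RingHom.ker ρ = 𝔭.map (C : R →+* R[X]) := by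
    rw [hρ, Polynomial.ker_mapRingHom, Ideal.mk_ker]
  have h𝔭𝔔 : 𝔭.map (C : R →+* R[X]) ≤ 𝔔 := by rw [Ideal.map_le_iff_le_comap, h𝔔]
  have hker𝔔 : RingHom.ker ρ ≤ 𝔔 := hker ▸ h𝔭𝔔
  set Q : Ideal D[X] := 𝔔.map ρ with hQ
  haveI hQp : Q.IsPrime := Ideal.map_isPrime_of_surjective hρsurj hker𝔔
  have hcomapQ : Q.comap ρ = 𝔔 := by
    rw [hQ, Ideal.comap_map_of_surjective ρ hρsurj, ← RingHom.ker_eq_comap_bot, sup_eq_left.mpr hker𝔔]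
  have hQ0 : Q.comap (C : D →+* D[X]) = ⊥ := by
    refine (Submodule.eq_bot_iff _).mpr fun d hd => ?_
    obtain ⟨d, rfl⟩ := Ideal.Quotient.mk_surjective d
    rw [Ideal.mem_comap, ← Polynomial.map_C (Ideal.Quotient.mk 𝔭), ← Polynomial.coe_mapRingHom, ← hρ, ← Ideal.mem_comap, hcomapQ,
      ← Ideal.mem_comap, h𝔔] at hd
    exact Ideal.Quotient.eq_zero_iff_mem.mpr hd
  -- the reduced equation `g = h mod 𝔭` has multiplicity `m` at `Q`
  set g := h.map (Ideal.Quotient.mk 𝔭) with hg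
  have hgmo : g.Monic := hmo.map _
  have hgdeg : g.natDegree = m := hmo.natDegree_map _
  obtain ⟨s, hs𝔔, hsh⟩ := hord
  have hordQ : ∃ s' ∉ Q, s' * g ∈ Q ^ g.natDegree := by
    refine ⟨ρ s, fun h1 => hs𝔔 (hcomapQ ▸ Ideal.mem_comap.mpr h1), ?_⟩
    rw [hgdeg, hg, ← Polynomial.coe_mapRingHom, ← hρ, ← map_mul, hQ, ← Ideal.map_pow]
    exact Ideal.mem_map_of_mem _ hsh
  obtain ⟨lam, hglam, hQlam⟩ := exists_eq_X_sub_C_pow_of_mul_mem_pow hgmo (hgdeg ▸ hm) Q hQ0 hordQ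
  obtain ⟨lam₀, rfl⟩ := Ideal.Quotient.mk_surjective lam
  -- the coefficients of `h` modulo `𝔭`
  have hcoef𝔭 : ∀ j ∈ Finset.Icc 1 m, h.coeff (m - j) - (m.choose j : R) * (-lam₀) ^ j ∈ 𝔭 := by
    intro j hj
    have hj' := Finset.mem_Icc.mp hj
    rw [← Ideal.Quotient.eq, ← Polynomial.coeff_map, ← hg, hglam, hgdeg, sub_eq_add_neg, ← map_neg, ← map_neg,
      Polynomial.coeff_X_add_C_pow, Nat.choose_symm hj'.2, show m - (m - j) = j by omega, map_mul, map_pow, map_natCast,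
      mul_comm]
  -- `λ₀ ∈ 𝔭`: otherwise a solvable vertex
  have hlam𝔭 : lam₀ ∈ 𝔭 := by
    by_contra hlam
    have hlam0 : Ideal.Quotient.mk 𝔭 lam₀ ≠ 0 := fun h0 => hlam (Ideal.Quotient.eq_zero_iff_mem.mp h0)
    obtain ⟨r, hr, hr'⟩ := exists_mem_pow_not_mem_pow_succ' hlam0
    rw [hmaxD, Ideal.span_singleton_pow] at hr hr'
    obtain ⟨c, hc⟩ := Ideal.mem_span_singleton'.mp hr
    obtain ⟨c, rfl⟩ := Ideal.Quotient.mk_surjective c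
    have hcunit : IsUnit c := by
      by_contra hcu
      have hcm : Ideal.Quotient.mk 𝔭 c ∈ maximalIdeal D := (hmk𝔪 c).mpr ((IsLocalRing.mem_maximalIdeal _).mpr hcu)
      rw [hmaxD] at hcm
      obtain ⟨d, hd⟩ := Ideal.mem_span_singleton'.mp hcm
      apply hr'
      rw [← hc, ← hd, mul_assoc, ← pow_succ']
      exact Ideal.mul_mem_left _ _ (Ideal.mem_span_singleton_self _)
    have hlamc : lam₀ - c * u i₀ ^ r ∈ 𝔭 := by
      rw [← Ideal.Quotient.eq, ← hc, map_mul, map_pow]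
    refine not_isMinimal_of_coeff_sub_mem_span hz T i₀ hi₀ hT hchar hm hcunit r (fun j hj => ?_) hmin
    have h1 := hcoef𝔭 j hj
    rw [← Ideal.Quotient.eq] at h1 ⊢
    rw [h1]
    simp only [map_mul, map_pow, map_neg, map_natCast, ← hc]
    ring
  -- hence `g = X^m`, `Q = (X)`, `𝔔 = 𝔭·R[X] + (X)`
  have hlam0 : Ideal.Quotient.mk 𝔭 lam₀ = 0 := Ideal.Quotient.eq_zero_iff_mem.mpr hlam𝔭
  rw [hlam0, map_zero, sub_zero] at hQlam
  have h𝔔eq : 𝔔 = 𝔭.map (C : R →+* R[X]) ⊔ Ideal.span {X} := by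
    rw [← hcomapQ, hQlam]
    ext q
    rw [Ideal.mem_comap, Ideal.mem_span_singleton, Polynomial.X_dvd_iff, mem_map_C_sup_span_X_iff, hρ, Polynomial.coe_mapRingHom,
      Polynomial.coeff_map, Ideal.Quotient.eq_zero_iff_mem]
  refine ⟨h𝔔eq, ?_⟩
  -- legality, by the `𝔭`-primary calculus
  rw [h𝔔eq] at hs𝔔 hsh
  have hs0 : s.coeff 0 ∉ 𝔭 := fun h0 => hs𝔔 ((mem_map_C_sup_span_X_iff 𝔭 s).mpr h0)
  have hcoefsh : ∀ l, (s * h).coeff l ∈ 𝔭 ^ (m - l) := coeff_mem_pow_of_mem_pow_map_C_sup_span_X 𝔭 hsh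
  have hleg : ∀ b, h.coeff b ∈ 𝔭 ^ (m - b) := by
    intro b
    induction b using Nat.strong_induction_on with
    | _ b ih =>
      have hsum := hcoefsh b
      rw [Polynomial.coeff_mul, ← Finset.add_sum_erase _ _ (Finset.mem_antidiagonal.mpr (zero_add b) : ((0, b) : ℕ × ℕ) ∈ _)]
        at hsum
      have hrest : ∑ x ∈ (Finset.antidiagonal b).erase (0, b), s.coeff x.1 * h.coeff x.2 ∈ 𝔭 ^ (m - b) := by
        refine Ideal.sum_mem _ fun x hx => ?_
        obtain ⟨hxne, hx'⟩ := Finset.mem_erase.mp hx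
        have hx'' := Finset.mem_antidiagonal.mp hx'
        have hlt : x.2 < b := by
          by_contra hge
          apply hxne
          have h2 : x.2 = b := by omega
          have h1 : x.1 = 0 := by omega
          exact Prod.ext h1 h2
        exact Ideal.pow_le_pow_right (by omega) (Ideal.mul_mem_left _ _ (ih x.2 hlt))
      have hmain : s.coeff 0 * h.coeff b ∈ 𝔭 ^ (m - b) := by
        have := Ideal.sub_mem _ hsum hrest
        simpa using this
      exact mem_pow_span_image_rsop_of_mul_mem hd u hu T hs0 (m - b) hmain
  intro i hi
  have hi' := Finset.mem_Icc.mp hi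
  have := hleg (m - i)
  rwa [show m - (m - i) = i by omega] at this

end Face

end Summit.ResolutionOfSingularities.ResolutionOfSingularities.Theorems.SigmaMaxModificationsCorridor3.Helpers

end
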